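import Literature.Geometry.Lorentzian.CauchyDevelopmentIsometryClasses
import Mathlib.Geometry.Manifold.LocalDiffeomorph
import HarnessLib

/-!
# Pulling back causal curves and causal futures along an injective local isometry

Companion to `Literature.Geometry.Lorentzian.TimelikeCurveLift` (which lifts ENDLESS TIMELIKE
curves along an injective local isometry, Sbierski 2016, §3.3): the elementary causal version,
without endlessness.  For `Φ : N → P` an injective `C^∞` local diffeomorphism between
time-oriented Lorentzian manifolds which is an isometric immersion preserving the time
orientations:

* `LorentzianMetric.IsFutureCausalCurveOn.invFun_comp` — a future causal curve `γ` of `P` on a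
  parameter set `s` with `γ(s) ⊆ Φ(N)` pulls back to the future causal curve `Φ⁻¹ ∘ γ`
  (`Function.invFun Φ ∘ γ`) of `N` on `s`: locally `Φ⁻¹ ∘ γ = e⁻¹ ∘ γ` for a smooth local inverse
  `e⁻¹` of `Φ` (injectivity makes the lift single valued), so it is differentiable with
  `dΦ(δ') = γ'`, and `δ'` is future-directed by the converse timecone lemma
  (`TimeOrientation.PreservesTimeOrientation.isFutureDirected_of_mfderiv`);
* `LorentzianMetric.invFun_mem_causalFuture` — consequently, if every future causal curve of `P`
  on a compact parameter interval issuing from `Φ(S)` stays inside `Φ(N)`, then `Φ⁻¹` maps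
  `J⁺_P(Φ(S)) ∩ Φ(N)` into `J⁺_N(S)` (O'Neill 1983, Ch. 14, pp. 402–403: `J⁺` is generated by
  future causal curves on compact intervals).

Everything is proved; no definitions and no named facts are introduced.

## References

* B. O'Neill, *Semi-Riemannian geometry with applications to relativity*, Academic Press 1983,
  Ch. 3, pp. 90–91 (local isometries); Ch. 5, p. 145 (timecones); Ch. 14, pp. 402–403 (`J⁺`).
* J. Sbierski, Ann. Henri Poincaré 17 (2016) 301–329, §3.3 (the timelike analogue).
-/

noncomputable section

open Bundle Set Function Filter Manifold
open scoped Manifold ContDiff Topology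

namespace Literature.Geometry.Lorentzian

section Lift

variable {EN : Type*} [NormedAddCommGroup EN] [NormedSpace ℝ EN] {HN : Type*} [TopologicalSpace HN]
  {IN : ModelWithCorners ℝ EN HN} {N : Type*} [TopologicalSpace N] [ChartedSpace HN N]
  [IsManifold IN ∞ N]
  {EP : Type*} [NormedAddCommGroup EP] [NormedSpace ℝ EP] {HP : Type*} [TopologicalSpace HP]
  {IP : ModelWithCorners ℝ EP HP} {P : Type*} [TopologicalSpace P] [ChartedSpace HP P]
  [IsManifold IP ∞ P]
  {gN : LorentzianMetric IN ∞ N} {τN : TimeOrientation gN}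
  {gP : LorentzianMetric IP ∞ P} {τP : TimeOrientation gP} {Φ : N → P}

/-- **Future causal curves inside the range of an injective local isometry pull back to future
causal curves.**  Let `Φ : N → P` be an injective `C^∞` local diffeomorphism between
time-oriented Lorentzian manifolds which is an isometric immersion preserving the time
orientations, and `γ` a future causal curve of `P` on `s` with `γ(s) ⊆ Φ(N)`.  Then
`Function.invFun Φ ∘ γ` is a future causal curve of `N` on `s`: near each parameter it is
`e⁻¹ ∘ γ` for a smooth local inverse `e⁻¹` of `Φ`, hence differentiable with `dΦ(δ') = γ'`, and
`δ'` is future-directed by the converse timecone lemma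
(`PreservesTimeOrientation.isFutureDirected_of_mfderiv`).  O'Neill 1983, Ch. 3, pp. 90–91 and
Ch. 14, p. 402. [cite: ONeillSemiRiemannian1983, Ch. 14, p. 402] -/
theorem LorentzianMetric.IsFutureCausalCurveOn.invFun_comp [Nonempty N]
    (hΦ : gN.IsIsometricImmersion gP.toPseudoRiemannianMetric Φ)
    (hτ : τN.PreservesTimeOrientation Φ τP) (hinj : Injective Φ)
    (hloc : IsLocalDiffeomorph IN IP ∞ Φ)
    {γ : ℝ → P} {s : Set ℝ} (hγ : gP.IsFutureCausalCurveOn τP γ s)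
    (hs : ∀ t ∈ s, γ t ∈ range Φ) :
    gN.IsFutureCausalCurveOn τN (Function.invFun Φ ∘ γ) s := by
  intro t ht
  set δ : ℝ → N := Function.invFun Φ ∘ γ with hδ_def
  have hΦδ : Φ (δ t) = γ t := Function.invFun_eq (hs t ht)
  obtain ⟨e, hsrc, heq⟩ := hloc (δ t)
  have htgt : γ t ∈ e.target := by
    rw [← hΦδ, heq hsrc]
    exact e.map_source hsrc
  have hγd : MDifferentiableAt 𝓘(ℝ, ℝ) IP γ t := (hγ t ht).1
  have hnhds : ∀ᶠ t' in 𝓝 t, γ t' ∈ e.target :=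
    hγd.continuousAt.preimage_mem_nhds (e.open_target.mem_nhds htgt)
  have hright : ∀ t', γ t' ∈ e.target → Φ (e.symm (γ t')) = γ t' := fun t' ht' ↦ by
    have hw : e.symm (γ t') ∈ e.source := e.map_target ht'
    rw [heq hw]
    exact e.right_inv ht'
  have hev : δ =ᶠ[𝓝 t] (e.symm ∘ γ) := by
    filter_upwards [hnhds] with t' ht'
    show Function.invFun Φ (γ t') = e.symm (γ t')
    conv_lhs => rw [← hright t' ht']
    exact Function.leftInverse_invFun hinj _
  have hes : ContMDiffAt IP IN ∞ e.symm (γ t) :=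
    e.contMDiffOn_invFun.contMDiffAt (e.open_target.mem_nhds htgt)
  have hδd : MDifferentiableAt 𝓘(ℝ, ℝ) IN δ t :=
    hev.mdifferentiableAt_iff.2 ((hes.mdifferentiableAt (by simp)).comp t hγd)
  have hev2 : γ =ᶠ[𝓝 t] (Φ ∘ δ) := by
    filter_upwards [hev, hnhds] with t' h1 h2
    show γ t' = Φ (δ t')
    rw [h1]
    exact (hright t' h2).symm
  have hΦd : MDifferentiable IN IP Φ := hΦ.1.mdifferentiable (by simp)
  have hv : mfderiv IN IP Φ (δ t) (velocity IN δ t) = velocity IP γ t := by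
    have h1 : mfderiv 𝓘(ℝ, ℝ) IP γ t =
        (mfderiv IN IP Φ (δ t)).comp (mfderiv 𝓘(ℝ, ℝ) IN δ t) := by
      rw [hev2.mfderiv_eq, mfderiv_comp t (hΦd _) hδd]
    change mfderiv IN IP Φ (δ t) (mfderiv 𝓘(ℝ, ℝ) IN δ t (1 : ℝ)) =
      mfderiv 𝓘(ℝ, ℝ) IP γ t (1 : ℝ)
    rw [h1]
    rfl
  refine ⟨hδd, ?_⟩
  have hfd : τP.IsFutureDirected (x := Φ (δ t)) (mfderiv IN IP Φ (δ t) (velocity IN δ t)) := by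
    rw [hv]
    have hgen : ∀ p, p = γ t → τP.IsFutureDirected (x := p) (velocity IP γ t) := by
      rintro p rfl
      exact (hγ t ht).2
    exact hgen _ hΦδ
  exact hτ.isFutureDirected_of_mfderiv hΦ.2 hfd

/-- **`Φ⁻¹` maps `J⁺_P(Φ(S)) ∩ Φ(N)` into `J⁺_N(S)` when causal curves from `Φ(S)` stay in
`Φ(N)`.**  For `Φ` as in `IsFutureCausalCurveOn.invFun_comp`: if every future causal curve of
`P` on a compact parameter interval issuing from a point of `Φ(S)` stays inside `Φ(N)`, then for
every `q ∈ J⁺_P(Φ(S))` of the form `q = Φ x` the point `x = Φ⁻¹ q` lies in `J⁺_N(S)` (the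
connecting causal curve pulls back along `Φ⁻¹`, with the right endpoints by injectivity).
O'Neill 1983, Ch. 14, pp. 402–403. [cite: ONeillSemiRiemannian1983, Ch. 14, pp. 402–403] -/
theorem LorentzianMetric.invFun_mem_causalFuture [Nonempty N]
    (hΦ : gN.IsIsometricImmersion gP.toPseudoRiemannianMetric Φ)
    (hτ : τN.PreservesTimeOrientation Φ τP) (hinj : Injective Φ)
    (hloc : IsLocalDiffeomorph IN IP ∞ Φ) {S : Set N}
    (hstay : ∀ (γ : ℝ → P) (a b : ℝ), a < b → gP.IsFutureCausalCurveOn τP γ (Icc a b) →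
      γ a ∈ Φ '' S → ∀ t ∈ Icc a b, γ t ∈ range Φ)
    {q : P} (hq : q ∈ gP.causalFuture τP (Φ '' S)) (hqΦ : q ∈ range Φ) :
    Function.invFun Φ q ∈ gN.causalFuture τN S := by
  obtain ⟨x, rfl⟩ := hqΦ
  rw [Function.leftInverse_invFun hinj x]
  rcases hq with ⟨y, hy, hyx⟩ | ⟨p, ⟨y, hy, rfl⟩, γ, a, b, hab, hγ, hγa, hγb⟩
  · exact Or.inl (hinj hyx ▸ hy)
  · have hs := hstay γ a b hab hγ ⟨y, hy, hγa.symm⟩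
    refine Or.inr ⟨y, hy, Function.invFun Φ ∘ γ, a, b, hab, hγ.invFun_comp hΦ hτ hinj hloc hs,
      ?_, ?_⟩
    · show Function.invFun Φ (γ a) = y
      rw [hγa]
      exact Function.leftInverse_invFun hinj y
    · show Function.invFun Φ (γ b) = x
      rw [hγb]
      exact Function.leftInverse_invFun hinj x

end Lift

end Literature.Geometry.Lorentzian

end
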